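import Summits.QuantumFields.YangMills.Theorems.BalabanUVNodesN07SlotCTraceSectors
import HarnessLib

/-!
# NODE N07 — `H₁(U₀; Δ₁)`, SECT. C's `H♭` AND THE SLOT-(c) `H₁` OF def-Y's SCHEME, READ IN THE TYPE OF (115), MAP TRACELESS BLOCK FIELDS TO TRACELESS JETS at every guarded
# background (every commuting slot; `N = 2` for the bare and the slot-(c) Hessians) — the trace companion of ✓p821715 §3 and ✓p822030's `equiv_H1OfRecordAtBg128_star`
# ([15] (45) p. 285, (102)–(103) p. 293, (115) p. 294, (51) p. 286; [B9] (3.126), (3.129) p. 421)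

Cell `pub-ymgap`, width seat `pub-ymgap-dag-n07-w3` (g26), CLAIM-23.  `--kind proof --supports stmt-QuantumFields-27238 --as helper`; count-neutral.
[15] = [Balaban1985Variational]; [B9] = [Balaban1985BackgroundPropagators].

CONTENTS (`S := scalPartW N _`; guard `SmallBelow (avOfRecord F N K) k U₀`).
* ★★`trace_equiv_H1OfRecordAt_eq_zero` — for a traceless block field `B` and any Hessian slot `Δ₁` commuting with `S`, every value of the jet `H₁(U₀; Δ₁) B` is traceless (`levB` arbitrary).
* ★★`trace_equiv_H1OfRecordAtBgFlat_eq_zero_two` — Sect. C's `H♭` (bare slot) at `N = 2`; ★★`trace_equiv_H1OfRecordAtBg128_eq_zero` ∕ `_two` — the slot-(c) `H₁` for commuting `G′`, `Δ⁽²⁾`.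

HONEST LABELS.  Linear bookkeeping; no estimate; the `𝔄 = H₁B(V)`-row still needs `B(V)` traceless (`tr log = log det` on `SU(N)` near `1`), and `C^{𝔰𝔩}`, `Emap`∕`W` their trace letters.  Count-neutral; N07 NOT
discharged; P0 ⟨26900⟩ OPEN; R4 is the conditional finite-𝕋⁴ rung only.  Nothing here is a claim about the Yang–Mills mass gap (`Summit.QuantumFields`): finite torus, fixed `ε`; nothing
continuum ∕ OS ∕ Clay.
-/

set_option autoImplicit false

noncomputable section

open scoped Matrix Matrix.Norms.L2Operator InnerProductSpace ComplexConjugate BigOperators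

namespace Summit.QuantumFields.YangMills.Theorems.N07H1ReadingTraceSectors

open Literature.MathematicalPhysics.QuantumFieldTheory.Balaban1983to89
open Literature.MathematicalPhysics.QuantumFieldTheory.Balaban1983to89.T4Continuum (T4Family)
open T4Continuum BlockAveraging
open Node00
open B9SectCLatticeCarrier (Bond)
open B9Eq311L2Pairing (WL2)
open B11Eq103H1Complex (SiteL2K BondL2K H1LatticeK H1LatticeCLM H1CLM_apply funEquiv)
open B11Eq115Space (NegSup NegSize levWeight JetSup)
open B11Eq111FrakG (nabla115)
open Summit.QuantumFields.YangMills.Theorems.N07TraceSectorDefs (scalPartW)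
open Summit.QuantumFields.YangMills.Theorems.N07TraceSectorProjection (scalPartW_comp_hessOpOfRecord_two)
open Summit.QuantumFields.YangMills.Theorems.N07H1OfRecordTraceSectors (scalPartW_H1LatticeK_ofRecord)
open Summit.QuantumFields.YangMills.Theorems.N07FrakGOfRecordTraceSectors (traceless_of_comm traceless_funEquiv_symm)
open Summit.QuantumFields.YangMills.Theorems.N07SlotCTraceSectors (scalPartW_hessOpOfRecord128)

section Reading

variable (F : T4Family) (N : ℕ) [NeZero N] {K : ℕ} (k : ℕ) (U₀ : GaugeField (F.P K) 0 (SU N)) [Fact (0 < c0Rec F K k)] [Fact (∀ c, 0 < wBRec F K k c)]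
  [Fact (0 < (F.L : ℝ))] [Fact (0 < (F.P K).eta k)] (Ω : ℕ → Set (Site (F.P K) 0))
  {Δ₁ : BondL2K ℂ (F.P K).d (fun _ => (F.P K).sitesPerDir 0) (c0Rec F K k) (WRec N) →ₗ[ℂ]
    BondL2K ℂ (F.P K).d (fun _ => (F.P K).sitesPerDir 0) (c0Rec F K k) (WRec N)} {a : ℝ}
  (hpos : ∀ x, x ≠ 0 → 0 < RCLike.re ⟪x, laplaceAOfRecordAt F N k U₀ Δ₁ (QOfRecord F N k U₀) (QflatOfRecord F N k) a x⟫_ℂ)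

/-- ★★ **THE JET `H₁(U₀; Δ₁) B` OF A TRACELESS BLOCK FIELD IS TRACELESS AT EVERY BOND** — for every Hessian slot `Δ₁` commuting with the scalar part, under 35b's guard (`levB` arbitrary).
[cite: Balaban1985Variational, (45) p.285, (103) p.293, (115) p.294, (51) p.286; Balaban1985BackgroundPropagators, (3.129) p.421] -/
theorem trace_equiv_H1OfRecordAt_eq_zero (levB : PBond (F.P K) k → ℕ) (h : SmallBelow (avOfRecord F N K) k U₀)
    (hΔ₁ : ∀ x, Δ₁ (scalPartW N _ x) = scalPartW N _ (Δ₁ x)) (hQ : Function.Surjective (QOfRecord F N k U₀))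
    {B : NegSize (F.L : ℝ) ((F.P K).eta k) levB 0 (Matrix (Fin N) (Fin N) ℂ)} (hB : ∀ c, (NegSup.equiv _ _ B c).trace = 0)
    (b : Bond (F.P K).d (fun _ => (F.P K).sitesPerDir 0)) :
    (JetSup.equiv _ _ (nabla115 ((F.P K).eta k) (unitsOfRecord F N U₀))
        (H1OfRecordAt F N K k Ω U₀ levB Δ₁ (QOfRecord F N k U₀) (QflatOfRecord F N k) a hpos hQ B) b).trace = 0 := by
  unfold H1OfRecordAt H1LatticeCLM
  rw [H1CLM_apply]
  exact traceless_of_comm N _ _ (scalPartW_H1LatticeK_ofRecord F N k U₀ hpos h hΔ₁ hQ) (traceless_funEquiv_symm N _ hB) b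

end Reading

section SU2

variable (F : T4Family) {K : ℕ} (k : ℕ) (U₀ : GaugeField (F.P K) 0 (SU 2)) [Fact (0 < c0Rec F K k)] [Fact (∀ c, 0 < wBRec F K k c)]
  [Fact (0 < (F.L : ℝ))] [Fact (0 < (F.P K).eta k)] (Ω : ℕ → Set (Site (F.P K) 0))

set_option maxRecDepth 16384 in
/-- ★★ **SECT. C's `H♭ = H1OfRecordAtBgFlat` (bare slot, the `H` of def-Y's `WOfRecordAt`) MAPS TRACELESS BLOCK FIELDS TO TRACELESS JETS at `N = 2`**, under the guard.
[cite: Balaban1985Variational, (45)–(47) p.285, (103) p.293; Balaban1985BackgroundPropagators, (3.126) p.421] -/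
theorem trace_equiv_H1OfRecordAtBgFlat_eq_zero_two (levB : PBond (F.P K) k → ℕ) (h : SmallBelow (avOfRecord F 2 K) k U₀) {a : ℝ}
    (hposb : ∀ x, x ≠ 0 → 0 < RCLike.re ⟪x, laplaceAOfRecord F 2 k U₀ (QOfRecord F 2 k U₀) (QflatOfRecord F 2 k) a x⟫_ℂ)
    (hQ : Function.Surjective (QOfRecord F 2 k U₀))
    {B : NegSize (F.L : ℝ) ((F.P K).eta k) levB 0 (Matrix (Fin 2) (Fin 2) ℂ)} (hB : ∀ c, (NegSup.equiv _ _ B c).trace = 0)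
    (b : Bond (F.P K).d (fun _ => (F.P K).sitesPerDir 0)) :
    (JetSup.equiv _ _ (nabla115 ((F.P K).eta k) (unitsOfRecord F 2 U₀)) (H1OfRecordAtBgFlat F 2 K k Ω U₀ levB a hposb hQ B) b).trace = 0 := by
  have hΔ : ∀ y : BondL2K ℂ (F.P K).d (fun _ => (F.P K).sitesPerDir 0) (c0Rec F K k) (WRec 2),
      hessOpOfRecord F 2 k U₀ (scalPartW 2 _ y) = scalPartW 2 _ (hessOpOfRecord F 2 k U₀ y) := fun y => by
    rw [← LinearMap.comp_apply, ← scalPartW_comp_hessOpOfRecord_two F K k U₀, LinearMap.comp_apply]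
  exact trace_equiv_H1OfRecordAt_eq_zero F 2 k U₀ Ω (Δ₁ := hessOpOfRecord F 2 k U₀) hposb levB h hΔ hQ hB b

variable {Gp : SiteL2K ℂ (F.P K).d (fun _ => (F.P K).sitesPerDir 0) (c0Rec F K k) (WRec 2) →ₗ[ℂ]
    SiteL2K ℂ (F.P K).d (fun _ => (F.P K).sitesPerDir 0) (c0Rec F K k) (WRec 2)}
  {Δ2 : BondL2K ℂ (F.P K).d (fun _ => (F.P K).sitesPerDir 0) (c0Rec F K k) (WRec 2) →ₗ[ℂ]
    BondL2K ℂ (F.P K).d (fun _ => (F.P K).sitesPerDir 0) (c0Rec F K k) (WRec 2)}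

set_option maxRecDepth 16384 in
set_option maxHeartbeats 800000 in
/-- ★★ **THE SLOT-(c) `H₁(U₀) = H1OfRecordAtBg128` MAPS TRACELESS BLOCK FIELDS TO TRACELESS JETS at `N = 2`** for commuting data `G′`, `Δ⁽²⁾`, under the guard.
[cite: Balaban1985Variational, (102)–(103) p.293; Balaban1985BackgroundPropagators, (3.128)–(3.129) p.421] -/
theorem trace_equiv_H1OfRecordAtBg128_eq_zero_two (levB : PBond (F.P K) k → ℕ) (h : SmallBelow (avOfRecord F 2 K) k U₀) {a : ℝ}
    (hGp : ∀ s, Gp (scalPartW 2 _ s) = scalPartW 2 _ (Gp s)) (hΔ2 : ∀ x, Δ2 (scalPartW 2 _ x) = scalPartW 2 _ (Δ2 x))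
    (hposπ : ∀ x, x ≠ 0 → 0 < RCLike.re ⟪x, laplaceAOfRecordAt F 2 k U₀ (hessOpOfRecord128 F 2 k U₀ Gp (QflatOfRecord F 2 k) Δ2)
      (QOfRecord F 2 k U₀) (QflatOfRecord F 2 k) a x⟫_ℂ)
    (hQ : Function.Surjective (QOfRecord F 2 k U₀))
    {B : NegSize (F.L : ℝ) ((F.P K).eta k) levB 0 (Matrix (Fin 2) (Fin 2) ℂ)} (hB : ∀ c, (NegSup.equiv _ _ B c).trace = 0)
    (b : Bond (F.P K).d (fun _ => (F.P K).sitesPerDir 0)) :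
    (JetSup.equiv _ _ (nabla115 ((F.P K).eta k) (unitsOfRecord F 2 U₀)) (H1OfRecordAtBg128 F 2 K k Ω U₀ levB Gp Δ2 a hposπ hQ B) b).trace = 0 := by
  have hΔ : ∀ y : BondL2K ℂ (F.P K).d (fun _ => (F.P K).sitesPerDir 0) (c0Rec F K k) (WRec 2),
      hessOpOfRecord F 2 k U₀ (scalPartW 2 _ y) = scalPartW 2 _ (hessOpOfRecord F 2 k U₀ y) := fun y => by
    rw [← LinearMap.comp_apply, ← scalPartW_comp_hessOpOfRecord_two F K k U₀, LinearMap.comp_apply]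
  exact trace_equiv_H1OfRecordAt_eq_zero F 2 k U₀ Ω (Δ₁ := hessOpOfRecord128 F 2 k U₀ Gp (QflatOfRecord F 2 k) Δ2) hposπ levB h
    (scalPartW_hessOpOfRecord128 F 2 k U₀ hGp hΔ hΔ2) hQ hB b

end SU2

end Summit.QuantumFields.YangMills.Theorems.N07H1ReadingTraceSectors

end
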